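import Literature.Topology.FourManifolds.ThreeTorusHomologyOne
import Literature.Topology.FourManifolds.LinkingNumberTorusClass
import Literature.AlgebraicTopology.SingularHomology.HOneProducts
import Mathlib.Analysis.SpecialFunctions.Complex.Circle
import HarnessLib

/-!
# Degrees of the standard self-maps of the torus on `H₂(T²; ℤ)`

Topic `Literature/Topology/FourManifolds`; third file of the proof of the symmetry of the linking
number (`Knot.HasLinkingNumber.symm`, Rolfsen, *Knots and Links* (1976), §5.D Thm. 5.D.1), see
`LinkingNumberTorusClass.lean` for the plan. After the boundary tori of a link exterior have been
compared with the model torus and mapped to `T² = S¹ × S¹` by the two circle-valued maps dual to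
the meridians, the cancellation `[∂N(K)] + [∂N(J)] = 0` becomes the relation
`(g_K)_* τ + (g_J)_* τ = 0` in `H₂(T²; ℤ)` for a nonzero class `τ` and two torus maps homotopic to
`(x, u) ↦ (u, x^b)`, `b = lk(J, K)`, and `(x, u) ↦ (x^a, u)`, `a = lk(K, J)`. This file computes
the action of these maps on `H₂(T²; ℤ)` — without cup products, Künneth or any orientation of the
torus, from the Mayer–Vietoris sequence alone (Hatcher, *Algebraic Topology* (2002), §2.2):

* **`CircleTorus.map_fibreMap`** — for `ψ : S¹ → S¹` and `a ∈ ℤ`, the fibre-preserving map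
  `(x, u) ↦ (x^a ψ(u), u)` acts on every `τ ∈ H₂(T²; ℤ)` as multiplication by `a`. Proof: cover
  `T²` by `S¹ × (S¹ ∖ {-1})` and `S¹ × (S¹ ∖ {1})`, both `≃ S¹` with `H₂ = 0` (Hatcher Cor. 2.11,
  Cor. 2.14), so the Mayer–Vietoris connecting map `H₂(T²) → H₁` of the intersection
  `S¹ × {Im u > 0} ⊔ S¹ × {Im u < 0}` is injective and natural; on each piece (`≃ S¹` by the first
  projection) the map induces `a · id` on `H₁`, by the additivity `(f · g)_* = f_* + g_*` on `H₁`
  of maps into a topological group (Hatcher §3.C Lemma 3C.3 / Thm. 2A.1, tree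
  `singularHomology.map_zpow_one`, `map_mul_one`).
* `CircleTorus.map_conj_swap` — conjugating by the coordinate swap preserves such scalar actions
  (`σ² = id`), so the shear `(x, u) ↦ (x, x u)` acts as `1` and `(x, u) ↦ (x, u⁻¹)` as `-1`.
* **`CircleTorus.map_swap`** — the swap `σ (x, u) = (u, x)` acts as `-1`, being the composite
  `L ∘ U⁻¹ ∘ L ∘ D'` of the shears `L (x, u) = (x, x u)`, `U⁻¹ (x, u) = (x u⁻¹, u)` and the
  inversion `D' (x, u) = (x, u⁻¹)` (the factorisation of `[[0,1],[1,0]]` in `GL₂(ℤ)`).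
* **`CircleTorus.map_swap_comp_powFst`** — `(x, u) ↦ (u, x^b)` acts as `-b`;
  `CircleTorus.map_powFst` — `(x, u) ↦ (x^a, u)` acts as `a`.
* **`CircleTorus.eq_zero_of_zsmul_eq_zero`** — `H₂(T²; ℤ)` has no torsion seen by these
  arguments: `n • τ = 0`, `n ≠ 0` forces `τ = 0` (`H₁` of the pieces embeds in `H₁(S¹) ≅ ℤ`).

Everything is proved; the only new data are the torus `CircleTorus = Circle × Circle`, its
standard self-maps and the auxiliary cover. No named fact is introduced.

## References

* A. Hatcher, *Algebraic Topology*, CUP (2002), §2.2 pp. 149–150 (Mayer–Vietoris), Cor. 2.11,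
  Cor. 2.14, §2.A Thm. 2A.1, §3.C Lemma 3C.3. [cite: HatcherAT2002, §2.2 pp. 149–150]
* D. Rolfsen, *Knots and Links* (1976), §5.D Thm. 5.D.1. [cite: Rolfsen1976, §5.D Thm 5.D.1]
-/

noncomputable section

open CategoryTheory Limits Set Function
open scoped unitInterval Real Topology
open Literature.AlgebraicTopology.SingularHomology

namespace Literature.Topology.FourManifolds

/-- Local notation: `𝕊 n` is the unit sphere in `EuclideanSpace ℝ (Fin (n + 1))`. -/
local notation "𝕊 " n:arg => (Metric.sphere (0 : EuclideanSpace ℝ (Fin (n + 1))) 1)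

/-- **The torus** `T² = S¹ × S¹`, modelled on Mathlib's circle group `Circle ⊆ ℂ` (a compact
commutative topological group). [folklore] -/
abbrev CircleTorus : Type := Circle × Circle

namespace CircleTorus

/-! ### The standard self-maps -/

/-- The coordinate swap `σ (x, u) = (u, x)`. [folklore] -/
def swap : C(CircleTorus, CircleTorus) := ContinuousMap.prodSwap

/-- The swap as a function. [folklore] -/
@[simp] theorem swap_apply (z : CircleTorus) : swap z = (z.2, z.1) := rfl

/-- **Fibre-preserving maps** `(x, u) ↦ (x^a ψ(u), u)` over the second factor. [folklore] -/
def fibreMap (a : ℤ) (ψ : C(Circle, Circle)) : C(CircleTorus, CircleTorus) where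
  toFun z := (z.1 ^ a * ψ z.2, z.2)
  continuous_toFun := by fun_prop

/-- A fibre-preserving map as a function. [folklore] -/
@[simp] theorem fibreMap_apply (a : ℤ) (ψ : C(Circle, Circle)) (z : CircleTorus) :
    fibreMap a ψ z = (z.1 ^ a * ψ z.2, z.2) := rfl

/-- `(x, u) ↦ (x^a, u)`. [folklore] -/
def powFst (a : ℤ) : C(CircleTorus, CircleTorus) := fibreMap a 1

/-- `powFst` as a function. [folklore] -/
@[simp] theorem powFst_apply (a : ℤ) (z : CircleTorus) : powFst a z = (z.1 ^ a, z.2) := by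
  simp [powFst]

/-- The shear `U (x, u) = (x u, u)`. [folklore] -/
def shearFst : C(CircleTorus, CircleTorus) := fibreMap 1 (ContinuousMap.id Circle)

/-- The shear `U` as a function. [folklore] -/
@[simp] theorem shearFst_apply (z : CircleTorus) : shearFst z = (z.1 * z.2, z.2) := by
  simp [shearFst]

/-- The inverse shear `U⁻¹ (x, u) = (x u⁻¹, u)`. [folklore] -/
def unshearFst : C(CircleTorus, CircleTorus) :=
  fibreMap 1 ⟨fun u : Circle ↦ u⁻¹, continuous_inv⟩

/-- The inverse shear `U⁻¹` as a function. [folklore] -/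
@[simp] theorem unshearFst_apply (z : CircleTorus) : unshearFst z = (z.1 * z.2⁻¹, z.2) := by
  simp [unshearFst]

/-- The inversion of the first factor `D (x, u) = (x⁻¹, u)`. [folklore] -/
def invFst : C(CircleTorus, CircleTorus) := fibreMap (-1) 1

/-- The inversion `D` as a function. [folklore] -/
@[simp] theorem invFst_apply (z : CircleTorus) : invFst z = (z.1⁻¹, z.2) := by
  simp [invFst]

/-- The shear `L (x, u) = (x, x u)`. [folklore] -/
def shearSnd : C(CircleTorus, CircleTorus) := swap.comp (shearFst.comp swap)

/-- The shear `L` as a function. [folklore] -/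
@[simp] theorem shearSnd_apply (z : CircleTorus) : shearSnd z = (z.1, z.1 * z.2) := by
  simp [shearSnd, mul_comm]

/-- The inversion of the second factor `D' (x, u) = (x, u⁻¹)`. [folklore] -/
def invSnd : C(CircleTorus, CircleTorus) := swap.comp (invFst.comp swap)

/-- The inversion `D'` as a function. [folklore] -/
@[simp] theorem invSnd_apply (z : CircleTorus) : invSnd z = (z.1, z.2⁻¹) := by
  simp [invSnd]

/-- **The swap is a product of shears and one inversion**: `σ = L ∘ U⁻¹ ∘ L ∘ D'`
(the factorisation `[[0,1],[1,0]] = [[1,0],[1,1]] [[1,-1],[0,1]] [[1,0],[1,1]] [[1,0],[0,-1]]`).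
[folklore] -/
theorem swap_eq_comp :
    swap = shearSnd.comp (unshearFst.comp (shearSnd.comp invSnd)) := by
  ext1 z
  simp only [ContinuousMap.comp_apply, invSnd_apply, shearSnd_apply, unshearFst_apply, swap_apply]
  refine Prod.ext ?_ ?_
  · show z.2 = z.1 * (z.1 * z.2⁻¹)⁻¹
    rw [mul_inv_rev, inv_inv, ← mul_assoc, mul_comm z.1 z.2, mul_assoc, mul_inv_cancel, mul_one]
  · show z.1 = z.1 * (z.1 * z.2⁻¹)⁻¹ * (z.1 * z.2⁻¹)
    rw [mul_assoc, inv_mul_cancel, mul_one]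

/-- The swap is an involution. [folklore] -/
theorem swap_comp_swap : swap.comp swap = ContinuousMap.id CircleTorus := by
  ext1 z; rfl

/-! ### Arcs of the circle and their contractions -/

/-- A unit complex number with vanishing imaginary part is `1` or `-1`. [folklore] -/
theorem _root_.Circle.eq_one_or_eq_neg_one_of_im_eq_zero (u : Circle) (h : (u : ℂ).im = 0) :
    u = 1 ∨ u = -1 := by
  have hn : (u : ℂ).re ^ 2 = 1 := by
    have := u.normSq_coe
    rw [Complex.normSq_apply, h, mul_zero, add_zero] at this
    nlinarith [this]
  have hn' : (u : ℂ).re * (u : ℂ).re = 1 := by nlinarith [hn]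
  rcases mul_self_eq_one_iff.1 hn' with hr | hr
  · left
    exact Circle.ext_iff.2 (Complex.ext (by simpa using hr) (by simpa using h))
  · right
    refine Circle.ext_iff.2 (Complex.ext ?_ ?_)
    · simpa using hr
    · simpa using h

/-- A unit complex number other than `-1` lies in the slit plane. [folklore] -/
theorem _root_.Circle.mem_slitPlane_of_ne_neg_one (u : Circle) (hu : u ≠ -1) :
    (u : ℂ) ∈ Complex.slitPlane := by
  rw [Complex.mem_slitPlane_iff]
  by_cases h : (u : ℂ).im = 0
  · rcases u.eq_one_or_eq_neg_one_of_im_eq_zero h with rfl | rfl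
    · left; simp
    · exact absurd rfl hu
  · exact Or.inr h

/-- `|arg u| < π` for a unit complex number `u ≠ -1`. [folklore] -/
theorem _root_.Circle.abs_arg_lt_pi (u : Circle) (hu : u ≠ -1) : |(u : ℂ).arg| < π := by
  rw [abs_lt]
  refine ⟨Complex.neg_pi_lt_arg _, lt_of_le_of_ne (Complex.arg_le_pi _) fun h ↦ hu ?_⟩
  rw [Complex.arg_eq_pi_iff] at h
  have him : (u : ℂ).im = 0 := h.2
  rcases u.eq_one_or_eq_neg_one_of_im_eq_zero him with rfl | rfl
  · norm_num at h
  · rfl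

/-- `Circle.exp s ≠ -1` for `|s| < π`. [folklore] -/
theorem _root_.Circle.exp_ne_neg_one {s : ℝ} (hs : |s| < π) : Circle.exp s ≠ -1 := by
  intro h
  have ha := Circle.arg_exp (abs_lt.1 hs).1 (abs_lt.1 hs).2.le
  rw [h] at ha
  have : ((-1 : Circle) : ℂ).arg = π := by simp
  rw [this] at ha
  exact (abs_lt.1 hs).2.ne' ha

/-- `0 < Im (Circle.exp s)` for `0 < s < π`. [folklore] -/
theorem _root_.Circle.im_exp_pos {s : ℝ} (h0 : 0 < s) (hπ : s < π) : 0 < (Circle.exp s : ℂ).im := by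
  rw [Circle.coe_exp, Complex.exp_ofReal_mul_I_im]
  exact Real.sin_pos_of_pos_of_lt_pi h0 hπ

/-- `Im (Circle.exp s) < 0` for `-π < s < 0`. [folklore] -/
theorem _root_.Circle.im_exp_neg {s : ℝ} (hπ : -π < s) (h0 : s < 0) : (Circle.exp s : ℂ).im < 0 := by
  rw [Circle.coe_exp, Complex.exp_ofReal_mul_I_im]
  exact Real.sin_neg_of_neg_of_neg_pi_lt h0 hπ

/-- The argument of a unit complex number with positive imaginary part lies in `(0, π)`.
[folklore] -/
theorem _root_.Circle.arg_mem_Ioo_of_im_pos (u : Circle) (h : 0 < (u : ℂ).im) :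
    (u : ℂ).arg ∈ Ioo 0 π := by
  refine ⟨lt_of_le_of_ne (Complex.arg_nonneg_iff.2 h.le) ?_, lt_of_le_of_ne (Complex.arg_le_pi _) ?_⟩
  · intro h0
    have := (Complex.arg_eq_zero_iff.1 h0.symm).2
    linarith
  · intro hπ
    have := (Complex.arg_eq_pi_iff.1 hπ).2
    linarith

/-- The argument of a unit complex number with negative imaginary part lies in `(-π, 0)`.
[folklore] -/
theorem _root_.Circle.arg_mem_Ioo_of_im_neg (u : Circle) (h : (u : ℂ).im < 0) :
    (u : ℂ).arg ∈ Ioo (-π) 0 :=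
  ⟨Complex.neg_pi_lt_arg _, Complex.arg_neg_iff.2 h⟩

/-- **A contraction of a subset `A ⊆ S¹` to a point inside `A`**: a jointly continuous family of
paths in `A` from a fixed point `u₀` (time `0`) to each `u ∈ A` (time `1`). [folklore] -/
structure Contraction (A : Set Circle) where
  /-- The centre. -/
  u₀ : Circle
  /-- The contraction `I × A → S¹`. -/
  c : C(I × ↥A, Circle)
  mem : ∀ t u, c (t, u) ∈ A
  apply_zero : ∀ u, c (0, u) = u₀
  apply_one : ∀ u, c (1, u) = u

namespace Contraction

variable {A : Set Circle}

/-- The centre of a contraction of a nonempty set belongs to it. [folklore] -/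
theorem u₀_mem (κ : Contraction A) (hA : A.Nonempty) : κ.u₀ ∈ A := by
  obtain ⟨u, hu⟩ := hA
  rw [← κ.apply_zero ⟨u, hu⟩]
  exact κ.mem 0 _

/-- A contractible arc is path connected. [folklore] -/
theorem isPathConnected (κ : Contraction A) (hA : A.Nonempty) : IsPathConnected A := by
  refine ⟨κ.u₀, κ.u₀_mem hA, fun u hu ↦ ?_⟩
  refine ⟨⟨⟨fun t ↦ κ.c (t, ⟨u, hu⟩), by fun_prop⟩, by simpa using κ.apply_zero ⟨u, hu⟩,
    by simpa using κ.apply_one ⟨u, hu⟩⟩, fun t ↦ κ.mem t _⟩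

end Contraction

/-- The contraction of `S¹ ∖ {-1}` to `1` along `t ↦ e^{i t arg u}`. [folklore] -/
def contractionNeNegOne : Contraction {u : Circle | u ≠ -1} where
  u₀ := 1
  c := ⟨fun p ↦ Circle.exp ((p.1 : ℝ) * (p.2 : ℂ).arg), by
    refine Circle.exp.continuous.comp ?_
    refine (continuous_subtype_val.comp continuous_fst).mul ?_
    refine continuous_iff_continuousAt.2 fun p ↦ ?_
    have hc : Continuous fun p : I × ↥{u : Circle | u ≠ -1} ↦ ((p.2 : Circle) : ℂ) := by fun_prop
    exact ContinuousAt.comp (f := fun p : I × ↥{u : Circle | u ≠ -1} ↦ ((p.2 : Circle) : ℂ))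
      (x := p) (Complex.continuousAt_arg (Circle.mem_slitPlane_of_ne_neg_one _ p.2.2))
      hc.continuousAt⟩
  mem t u := by
    refine Circle.exp_ne_neg_one (lt_of_le_of_lt ?_ (u.1.abs_arg_lt_pi u.2))
    rw [abs_mul]
    exact mul_le_of_le_one_left (abs_nonneg _) (by rw [abs_of_nonneg t.2.1]; exact t.2.2)
  apply_zero u := by simp
  apply_one u := by simp

/-- The contraction of `S¹ ∖ {1}` to `-1` along `t ↦ -e^{i t arg (-u)}`. [folklore] -/
def contractionNeOne : Contraction {u : Circle | u ≠ 1} where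
  u₀ := -1
  c := ⟨fun p ↦ -Circle.exp ((p.1 : ℝ) * (((-p.2.1 : Circle) : ℂ)).arg), by
    refine (Circle.exp.continuous.comp ?_).neg
    refine (continuous_subtype_val.comp continuous_fst).mul ?_
    refine continuous_iff_continuousAt.2 fun p ↦ ?_
    have hne : -p.2.1 ≠ -1 := fun h ↦ p.2.2 (neg_injective h)
    have hc : Continuous fun p : I × ↥{u : Circle | u ≠ 1} ↦ (((-p.2.1 : Circle)) : ℂ) := by fun_prop
    exact ContinuousAt.comp (f := fun p : I × ↥{u : Circle | u ≠ 1} ↦ (((-p.2.1 : Circle)) : ℂ))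
      (x := p) (Complex.continuousAt_arg (Circle.mem_slitPlane_of_ne_neg_one _ hne))
      hc.continuousAt⟩
  mem t u := by
    have hne : -u.1 ≠ -1 := fun h ↦ u.2 (neg_injective h)
    intro h
    have h' : Circle.exp ((t : ℝ) * (((-u.1 : Circle) : ℂ)).arg) = -1 := by
      have := congrArg Neg.neg h
      simpa using this
    refine Circle.exp_ne_neg_one (lt_of_le_of_lt ?_ ((-u.1).abs_arg_lt_pi hne)) h'
    rw [abs_mul]
    exact mul_le_of_le_one_left (abs_nonneg _) (by rw [abs_of_nonneg t.2.1]; exact t.2.2)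
  apply_zero u := by simp
  apply_one u := by
    have := Circle.exp_arg (-u.1)
    simp only [Set.Icc.coe_one, one_mul, ContinuousMap.coe_mk]
    rw [this, neg_neg]

/-- The contraction of the open upper semicircle to `i` along `t ↦ e^{i((1-t)π/2 + t arg u)}`.
[folklore] -/
def contractionImPos : Contraction {u : Circle | 0 < (u : ℂ).im} where
  u₀ := Circle.exp (π / 2)
  c := ⟨fun p ↦ Circle.exp ((1 - (p.1 : ℝ)) * (π / 2) + (p.1 : ℝ) * (p.2 : ℂ).arg), by
    refine Circle.exp.continuous.comp ?_
    refine ((continuous_const.sub (continuous_subtype_val.comp continuous_fst)).mul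
      continuous_const).add ?_
    refine (continuous_subtype_val.comp continuous_fst).mul ?_
    refine continuous_iff_continuousAt.2 fun p ↦ ?_
    have hs : (p.2 : ℂ) ∈ Complex.slitPlane := Complex.mem_slitPlane_iff.2 (Or.inr p.2.2.ne')
    have hc : Continuous fun p : I × ↥{u : Circle | 0 < (u : ℂ).im} ↦ ((p.2 : Circle) : ℂ) := by
      fun_prop
    exact ContinuousAt.comp (f := fun p : I × ↥{u : Circle | 0 < (u : ℂ).im} ↦ ((p.2 : Circle) : ℂ))
      (x := p) (Complex.continuousAt_arg hs) hc.continuousAt⟩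
  mem t u := by
    obtain ⟨h0, hπ⟩ := u.1.arg_mem_Ioo_of_im_pos u.2
    have ht0 : 0 ≤ (t : ℝ) := t.2.1
    have ht1 : (t : ℝ) ≤ 1 := t.2.2
    show 0 < (Circle.exp _ : ℂ).im
    refine Circle.im_exp_pos ?_ ?_
    · rcases eq_or_lt_of_le ht0 with h | h
      · rw [← h]; norm_num; positivity
      · nlinarith [Real.pi_pos]
    · nlinarith [Real.pi_pos]
  apply_zero u := by simp
  apply_one u := by simp

/-- The contraction of the open lower semicircle to `-i`. [folklore] -/
def contractionImNeg : Contraction {u : Circle | (u : ℂ).im < 0} where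
  u₀ := Circle.exp (-(π / 2))
  c := ⟨fun p ↦ Circle.exp ((1 - (p.1 : ℝ)) * (-(π / 2)) + (p.1 : ℝ) * (p.2 : ℂ).arg), by
    refine Circle.exp.continuous.comp ?_
    refine ((continuous_const.sub (continuous_subtype_val.comp continuous_fst)).mul
      continuous_const).add ?_
    refine (continuous_subtype_val.comp continuous_fst).mul ?_
    refine continuous_iff_continuousAt.2 fun p ↦ ?_
    have hs : (p.2 : ℂ) ∈ Complex.slitPlane := Complex.mem_slitPlane_iff.2 (Or.inr p.2.2.ne)
    have hc : Continuous fun p : I × ↥{u : Circle | (u : ℂ).im < 0} ↦ ((p.2 : Circle) : ℂ) := by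
      fun_prop
    exact ContinuousAt.comp (f := fun p : I × ↥{u : Circle | (u : ℂ).im < 0} ↦ ((p.2 : Circle) : ℂ))
      (x := p) (Complex.continuousAt_arg hs) hc.continuousAt⟩
  mem t u := by
    obtain ⟨hπ, h0⟩ := u.1.arg_mem_Ioo_of_im_neg u.2
    have ht0 : 0 ≤ (t : ℝ) := t.2.1
    have ht1 : (t : ℝ) ≤ 1 := t.2.2
    show (Circle.exp _ : ℂ).im < 0
    refine Circle.im_exp_neg ?_ ?_
    · nlinarith [Real.pi_pos]
    · rcases eq_or_lt_of_le ht0 with h | h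
      · rw [← h]; norm_num; positivity
      · nlinarith [Real.pi_pos]
  apply_zero u := by simp
  apply_one u := by simp

/-! ### Pieces `S¹ × A` of the torus -/

/-- The piece `S¹ × A` of the torus over `A ⊆ S¹`. [folklore] -/
def piece (A : Set Circle) : Set CircleTorus := {z | z.2 ∈ A}

/-- Membership in a piece. [folklore] -/
theorem mem_piece {A : Set Circle} (z : CircleTorus) : z ∈ piece A ↔ z.2 ∈ A := Iff.rfl

/-- The piece over an open set is open. [folklore] -/
theorem isOpen_piece {A : Set Circle} (hA : IsOpen A) : IsOpen (piece A) :=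
  hA.preimage continuous_snd

/-- A piece is a product set. [folklore] -/
theorem piece_eq_prod (A : Set Circle) : piece A = (univ : Set Circle) ×ˢ A := by
  ext z; simp [piece]

/-- A fibre-preserving map preserves every piece. [folklore] -/
theorem mapsTo_fibreMap_piece (a : ℤ) (ψ : C(Circle, Circle)) (A : Set Circle) :
    MapsTo (fibreMap a ψ) (piece A) (piece A) := fun _ hz ↦ hz

namespace Piece

variable {A : Set Circle}

/-- A contractible-arc piece is path connected. [folklore] -/
theorem pathConnectedSpace (κ : Contraction A) (hA : A.Nonempty) : PathConnectedSpace ↥(piece A) := by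
  rw [← isPathConnected_iff_pathConnectedSpace, piece_eq_prod]
  exact isPathConnected_univ.prod (κ.isPathConnected hA)

/-- The first projection of a piece. [folklore] -/
def proj (A : Set Circle) : C(↥(piece A), Circle) := ⟨fun z ↦ z.1.1, by fun_prop⟩

/-- The first projection as a function. [folklore] -/
@[simp] theorem proj_apply (z : ↥(piece A)) : proj A z = z.1.1 := rfl

/-- The section `x ↦ (x, u₀)` of the first projection. [folklore] -/
def sect (κ : Contraction A) (hA : A.Nonempty) : C(Circle, ↥(piece A)) :=
  ⟨fun x ↦ ⟨(x, κ.u₀), κ.u₀_mem hA⟩, by fun_prop⟩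

/-- `sect ∘ proj ≃ id` on a contractible-arc piece. [folklore] -/
theorem sect_comp_proj_homotopic (κ : Contraction A) (hA : A.Nonempty) :
    ((sect κ hA).comp (proj A)).Homotopic (ContinuousMap.id _) := by
  refine ⟨{ toFun := fun p ↦ ⟨(p.2.1.1, κ.c (p.1, ⟨p.2.1.2, p.2.2⟩)), κ.mem _ _⟩
            continuous_toFun := by fun_prop
            map_zero_left := fun z ↦ ?_
            map_one_left := fun z ↦ ?_ }⟩
  · apply Subtype.ext
    show (z.1.1, κ.c (0, ⟨z.1.2, z.2⟩)) = ((z.1.1, κ.u₀) : CircleTorus)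
    rw [κ.apply_zero]
  · apply Subtype.ext
    show (z.1.1, κ.c (1, ⟨z.1.2, z.2⟩)) = z.1
    rw [κ.apply_one]

/-- **The first projection is injective on `H₁` of a contractible-arc piece.** [folklore] -/
theorem map_proj_injective (κ : Contraction A) (hA : A.Nonempty) :
    Function.Injective (singularHomology.map ℤ ℤ (proj A) 1) := by
  intro y y' h
  have e := singularHomology.map_eq_of_homotopic ℤ ℤ (sect_comp_proj_homotopic κ hA) 1
  rw [singularHomology.map_comp, singularHomology.map_id] at e
  have hy := congrArg (fun φ ↦ φ y) e
  have hy' := congrArg (fun φ ↦ φ y') e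
  simp only [ModuleCat.comp_apply, ModuleCat.id_apply] at hy hy'
  rw [← hy, ← hy', h]

/-- The map `z ↦ ψ (z.2)` of a piece to `S¹`. [folklore] -/
def sndMap (A : Set Circle) (ψ : C(Circle, Circle)) : C(↥(piece A), Circle) :=
  ⟨fun z ↦ ψ z.1.2, by fun_prop⟩

/-- The map `z ↦ ψ (z.2)` as a function. [folklore] -/
@[simp] theorem sndMap_apply (ψ : C(Circle, Circle)) (z : ↥(piece A)) : sndMap A ψ z = ψ z.1.2 := rfl

/-- A map of a contractible-arc piece to `S¹` factoring through the second coordinate is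
null-homotopic, hence zero on `H₁`. [folklore] -/
theorem map_sndMap_eq_zero (κ : Contraction A) (ψ : C(Circle, Circle)) :
    singularHomology.map ℤ ℤ (sndMap A ψ) 1 = 0 := by
  have h : (sndMap A ψ).Homotopic (ContinuousMap.const _ (ψ κ.u₀)) := by
    refine ⟨{ toFun := fun p ↦ ψ (κ.c (unitInterval.symm p.1, ⟨p.2.1.2, p.2.2⟩))
              continuous_toFun := by fun_prop
              map_zero_left := fun z ↦ ?_
              map_one_left := fun z ↦ ?_ }⟩
    · show ψ (κ.c (unitInterval.symm 0, ⟨z.1.2, z.2⟩)) = ψ z.1.2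
      rw [unitInterval.symm_zero, κ.apply_one]
    · show ψ (κ.c (unitInterval.symm 1, ⟨z.1.2, z.2⟩)) = ψ κ.u₀
      rw [unitInterval.symm_one, κ.apply_zero]
  rw [singularHomology.map_eq_of_homotopic ℤ ℤ h 1]
  exact singularHomology.map_const ℤ ℤ _ one_ne_zero

/-- **A fibre-preserving map `(x, u) ↦ (x^a ψ(u), u)` acts as `a` on `H₁` of a contractible-arc
piece**: composed with the first projection it is the pointwise product `proj^a · (ψ ∘ snd)` in the
topological group `S¹`, and `(f · g)_* = f_* + g_*`, `(f^a)_* = a f_*` on `H₁`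
(Hatcher 2002, §3.C Lemma 3C.3; tree `map_mul_one`, `map_zpow_one`). [cite: HatcherAT2002, §3.C Lemma 3C.3] -/
theorem map_fibreMap_piece (κ : Contraction A) (hA : A.Nonempty) (a : ℤ) (ψ : C(Circle, Circle))
    (h : MapsTo (fibreMap a ψ) (piece A) (piece A)) (y : singularHomology ℤ ℤ ↥(piece A) 1) :
    singularHomology.map ℤ ℤ (subsetRestrict (fibreMap a ψ) h) 1 y = a • y := by
  haveI := pathConnectedSpace κ hA
  have hpf : (proj A).comp (subsetRestrict (fibreMap a ψ) h) = proj A ^ a * sndMap A ψ := by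
    ext1 z
    rfl
  apply map_proj_injective κ hA
  rw [← ModuleCat.comp_apply, ← singularHomology.map_comp, hpf, singularHomology.map_mul_one,
    singularHomology.map_zpow_one, map_sndMap_eq_zero κ, add_zero, map_zsmul]
  rfl

end Piece

/-! ### The Mayer–Vietoris cover `S¹ × (S¹ ∖ {-1}) ∪ S¹ × (S¹ ∖ {1})` -/

/-- The first set of the cover, `S¹ × (S¹ ∖ {-1})`. [folklore] -/
def V₁ : Set CircleTorus := piece {u | u ≠ -1}

/-- The second set of the cover, `S¹ × (S¹ ∖ {1})`. [folklore] -/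
def V₂ : Set CircleTorus := piece {u | u ≠ 1}

/-- `V₁` is open. [folklore] -/
theorem isOpen_V₁ : IsOpen V₁ := isOpen_piece (isOpen_ne)

/-- `V₂` is open. [folklore] -/
theorem isOpen_V₂ : IsOpen V₂ := isOpen_piece (isOpen_ne)

/-- `1 ≠ -1` on the circle. [folklore] -/
theorem one_ne_neg_one_circle : (1 : Circle) ≠ -1 := by
  intro h
  have := congrArg (fun z : Circle ↦ (z : ℂ).re) h
  norm_num at this

/-- The cover condition `V₁ ∪ V₂ = T²`. [folklore] -/
theorem interior_V₁_union_interior_V₂ : interior V₁ ∪ interior V₂ = univ := by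
  rw [isOpen_V₁.interior_eq, isOpen_V₂.interior_eq]
  refine eq_univ_of_forall fun z ↦ ?_
  by_cases h : z.2 = 1
  · left
    show z.2 ≠ -1
    rw [h]
    exact one_ne_neg_one_circle
  · exact Or.inr h

/-- A fibre-preserving map preserves `V₁`. [folklore] -/
theorem mapsTo_fibreMap_V₁ (a : ℤ) (ψ : C(Circle, Circle)) : MapsTo (fibreMap a ψ) V₁ V₁ :=
  mapsTo_fibreMap_piece a ψ _

/-- A fibre-preserving map preserves `V₂`. [folklore] -/
theorem mapsTo_fibreMap_V₂ (a : ℤ) (ψ : C(Circle, Circle)) : MapsTo (fibreMap a ψ) V₂ V₂ :=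
  mapsTo_fibreMap_piece a ψ _

/-- A fibre-preserving map preserves `Wpos`-type pieces (restatement for the two pieces of
`V₁ ∩ V₂`). [folklore] -/
theorem mapsTo_fibreMap_inter (a : ℤ) (ψ : C(Circle, Circle)) :
    MapsTo (fibreMap a ψ) (V₁ ∩ V₂) (V₁ ∩ V₂) :=
  (mapsTo_fibreMap_V₁ a ψ).inter_inter (mapsTo_fibreMap_V₂ a ψ)

/-- `H₂(S¹; ℤ) = 0` (Hatcher 2002, Cor. 2.14; tree `isZero_singularHomology_sphere_holds` and the
homeomorphism `Circle ≃ₜ 𝕊¹`). [cite: HatcherAT2002, Cor. 2.14] -/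
theorem isZero_singularHomology_circle_two : IsZero (singularHomology ℤ ℤ Circle 2) :=
  (isZero_singularHomology_sphere_holds ℤ ℤ (n := 1) (k := 2) two_ne_zero (by norm_num)).of_iso
    (singularHomology.mapIso ℤ ℤ circleHomeomorphSphereOne 2)

/-- **`H₂` of a contractible-arc piece vanishes**: the piece retracts by deformation onto a circle
fibre (Hatcher 2002, Cor. 2.11 with Cor. 2.14). [cite: HatcherAT2002, Cor. 2.11] -/
theorem isZero_singularHomology_piece_two {A : Set Circle} (κ : Contraction A) (hA : A.Nonempty) :
    IsZero (singularHomology ℤ ℤ ↥(piece A) 2) := by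
  rw [IsZero.iff_id_eq_zero]
  have e := singularHomology.map_eq_of_homotopic ℤ ℤ (Piece.sect_comp_proj_homotopic κ hA) 2
  rw [singularHomology.map_comp, singularHomology.map_id] at e
  rw [← e, isZero_singularHomology_circle_two.eq_of_tgt
    (singularHomology.map ℤ ℤ (Piece.proj A) 2) 0, zero_comp]

/-- The Mayer–Vietoris connecting map `δ : H₂(T²) → H₁(V₁ ∩ V₂)` of the cover. [folklore] -/
def δ₂ : singularHomology ℤ ℤ CircleTorus 2 ⟶ singularHomology ℤ ℤ ↥(V₁ ∩ V₂) 1 :=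
  mayerVietoris.δ ℤ ℤ V₁ V₂
    (relativeSingularHomology.isIso_map_of_interior_union_interior_holds ℤ ℤ CircleTorus)
    interior_V₁_union_interior_V₂ 1

/-- **`δ : H₂(T²) → H₁(V₁ ∩ V₂)` is injective**, as `H₂(V₁) = H₂(V₂) = 0`
(exactness of Mayer–Vietoris at `H₂(T²)`, Hatcher 2002, §2.2). [cite: HatcherAT2002, §2.2 pp. 149–150] -/
theorem mono_δ₂ : Mono δ₂ := by
  have hexc := relativeSingularHomology.isIso_map_of_interior_union_interior_holds ℤ ℤ CircleTorus
  have h₁ : IsZero (singularHomology ℤ ℤ ↥V₁ 2) :=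
    isZero_singularHomology_piece_two contractionNeNegOne ⟨1, one_ne_neg_one_circle⟩
  have h₂ : IsZero (singularHomology ℤ ℤ ↥V₂ 2) :=
    isZero_singularHomology_piece_two contractionNeOne ⟨-1, one_ne_neg_one_circle.symm⟩
  have hψ : mayerVietoris.ψ ℤ ℤ V₁ V₂ 2 = 0 := by
    refine biprod.hom_ext' _ _ ?_ ?_
    · rw [comp_zero]; exact h₁.eq_of_src _ _
    · rw [comp_zero]; exact h₂.eq_of_src _ _
  exact (mayerVietoris.exact₂_holds ℤ ℤ V₁ V₂ hexc interior_V₁_union_interior_V₂ 1).mono_g hψ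

/-- `δ : H₂(T²) → H₁(V₁ ∩ V₂)` is injective, as a function. [folklore] -/
theorem δ₂_injective : Function.Injective δ₂ :=
  (ModuleCat.mono_iff_injective _).1 mono_δ₂

/-! ### The action of fibre-preserving maps on `H₁(V₁ ∩ V₂)` -/

/-- The upper piece `S¹ × {Im u > 0}`. [folklore] -/
def Wpos : Set CircleTorus := piece {u | 0 < (u : ℂ).im}

/-- The lower piece `S¹ × {Im u < 0}`. [folklore] -/
def Wneg : Set CircleTorus := piece {u | (u : ℂ).im < 0}

/-- The upper piece is open. [folklore] -/
theorem isOpen_Wpos : IsOpen Wpos :=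
  isOpen_piece (isOpen_lt continuous_const (Complex.continuous_im.comp continuous_subtype_val))

/-- The lower piece is open. [folklore] -/
theorem isOpen_Wneg : IsOpen Wneg :=
  isOpen_piece (isOpen_lt (Complex.continuous_im.comp continuous_subtype_val) continuous_const)

/-- The upper and lower pieces are disjoint. [folklore] -/
theorem disjoint_Wpos_Wneg : Disjoint Wpos Wneg :=
  Set.disjoint_left.2 fun z (h : 0 < (z.2 : ℂ).im) (h' : (z.2 : ℂ).im < 0) ↦ lt_asymm h h'

/-- The upper piece lies in `V₁ ∩ V₂`. [folklore] -/
theorem Wpos_subset : Wpos ⊆ V₁ ∩ V₂ := by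
  intro z (hz : 0 < (z.2 : ℂ).im)
  constructor
  · intro (h : z.2 = -1); rw [h] at hz; norm_num at hz
  · intro (h : z.2 = 1); rw [h] at hz; norm_num at hz

/-- The lower piece lies in `V₁ ∩ V₂`. [folklore] -/
theorem Wneg_subset : Wneg ⊆ V₁ ∩ V₂ := by
  intro z (hz : (z.2 : ℂ).im < 0)
  constructor
  · intro (h : z.2 = -1); rw [h] at hz; norm_num at hz
  · intro (h : z.2 = 1); rw [h] at hz; norm_num at hz

/-- `V₁ ∩ V₂` is covered by the upper and lower pieces. [folklore] -/
theorem inter_subset_Wpos_union_Wneg : V₁ ∩ V₂ ⊆ Wpos ∪ Wneg := by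
  rintro z ⟨h₁, h₂⟩
  rcases lt_trichotomy 0 (z.2 : ℂ).im with h | h | h
  · exact Or.inl h
  · rcases z.2.eq_one_or_eq_neg_one_of_im_eq_zero h.symm with h' | h'
    · exact absurd h' h₂
    · exact absurd h' h₁
  · exact Or.inr h

/-- **A fibre-preserving map `(x, u) ↦ (x^a ψ(u), u)` acts as `a` on `H₁(V₁ ∩ V₂)`**: the
intersection is the disjoint union of the upper and the lower piece (additivity, Hatcher Prop. 2.6),
on each of which it acts as `a` (`Piece.map_fibreMap_piece`). [cite: HatcherAT2002, Prop. 2.6] -/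
theorem map_fibreMap_inter (a : ℤ) (ψ : C(Circle, Circle))
    (y : singularHomology ℤ ℤ ↥(V₁ ∩ V₂) 1) :
    singularHomology.map ℤ ℤ (subsetRestrict (fibreMap a ψ) (mapsTo_fibreMap_inter a ψ)) 1 y =
      a • y := by
  obtain ⟨yp, yn, rfl⟩ := singularHomology.exists_eq_map_add_map_of_disjoint_open isOpen_Wpos
    isOpen_Wneg disjoint_Wpos_Wneg Wpos_subset Wneg_subset inter_subset_Wpos_union_Wneg 1 y
  have hWp : MapsTo (fibreMap a ψ) Wpos Wpos := mapsTo_fibreMap_piece a ψ _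
  have hWn : MapsTo (fibreMap a ψ) Wneg Wneg := mapsTo_fibreMap_piece a ψ _
  have hp : (subsetRestrict (fibreMap a ψ) (mapsTo_fibreMap_inter a ψ)).comp
      (subsetInclusion Wpos_subset) =
        (subsetInclusion Wpos_subset).comp (subsetRestrict (fibreMap a ψ) hWp) := by
    ext1 z; rfl
  have hn : (subsetRestrict (fibreMap a ψ) (mapsTo_fibreMap_inter a ψ)).comp
      (subsetInclusion Wneg_subset) =
        (subsetInclusion Wneg_subset).comp (subsetRestrict (fibreMap a ψ) hWn) := by
    ext1 z; rfl
  have hne_p : ({u : Circle | 0 < (u : ℂ).im}).Nonempty :=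
    ⟨Circle.exp (π / 2), Circle.im_exp_pos (by positivity) (by linarith [Real.pi_pos])⟩
  have hne_n : ({u : Circle | (u : ℂ).im < 0}).Nonempty :=
    ⟨Circle.exp (-(π / 2)), Circle.im_exp_neg (by linarith [Real.pi_pos]) (by linarith [Real.pi_pos])⟩
  have ep : singularHomology.map ℤ ℤ (subsetRestrict (fibreMap a ψ) hWp) 1 yp = a • yp :=
    Piece.map_fibreMap_piece contractionImPos hne_p a ψ hWp yp
  have en : singularHomology.map ℤ ℤ (subsetRestrict (fibreMap a ψ) hWn) 1 yn = a • yn :=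
    Piece.map_fibreMap_piece contractionImNeg hne_n a ψ hWn yn
  rw [map_add, ← ModuleCat.comp_apply, ← ModuleCat.comp_apply, ← singularHomology.map_comp,
    ← singularHomology.map_comp, hp, hn, singularHomology.map_comp, singularHomology.map_comp,
    ModuleCat.comp_apply, ModuleCat.comp_apply, ep, en, map_zsmul, map_zsmul, ← zsmul_add]

/-! ### Degrees of the standard maps on `H₂(T²; ℤ)` -/

/-- **A fibre-preserving map `(x, u) ↦ (x^a ψ(u), u)` acts on `H₂(T²; ℤ)` as multiplication by
`a`**: naturality of the injective Mayer–Vietoris connecting map (Hatcher 2002, §2.2 p. 150) and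
`map_fibreMap_inter`. [cite: HatcherAT2002, §2.2 p. 150] -/
theorem map_fibreMap (a : ℤ) (ψ : C(Circle, Circle)) (τ : singularHomology ℤ ℤ CircleTorus 2) :
    singularHomology.map ℤ ℤ (fibreMap a ψ) 2 τ = a • τ := by
  have hexc := relativeSingularHomology.isIso_map_of_interior_union_interior_holds ℤ ℤ CircleTorus
  have nat := mayerVietoris.δ_naturality_holds ℤ ℤ hexc hexc (fibreMap a ψ)
    (mapsTo_fibreMap_V₁ a ψ) (mapsTo_fibreMap_V₂ a ψ)
    interior_V₁_union_interior_V₂ interior_V₁_union_interior_V₂ 1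
  apply δ₂_injective
  rw [map_zsmul]
  have e := congrArg (fun φ ↦ φ τ) nat
  simp only [ModuleCat.comp_apply] at e
  have e' : δ₂ (singularHomology.map ℤ ℤ (fibreMap a ψ) 2 τ) =
      singularHomology.map ℤ ℤ (subsetRestrict (fibreMap a ψ) (mapsTo_fibreMap_inter a ψ)) 1
        (δ₂ τ) := e.symm
  rw [e', map_fibreMap_inter]

/-- `(x, u) ↦ (x^a, u)` acts as `a` on `H₂(T²; ℤ)`. [folklore] -/
theorem map_powFst (a : ℤ) (τ : singularHomology ℤ ℤ CircleTorus 2) :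
    singularHomology.map ℤ ℤ (powFst a) 2 τ = a • τ :=
  map_fibreMap a 1 τ

/-- The shear `U` acts as the identity on `H₂(T²; ℤ)`. [folklore] -/
theorem map_shearFst (τ : singularHomology ℤ ℤ CircleTorus 2) :
    singularHomology.map ℤ ℤ shearFst 2 τ = τ := by
  rw [shearFst, map_fibreMap, one_smul]

/-- The inverse shear `U⁻¹` acts as the identity on `H₂(T²; ℤ)`. [folklore] -/
theorem map_unshearFst (τ : singularHomology ℤ ℤ CircleTorus 2) :
    singularHomology.map ℤ ℤ unshearFst 2 τ = τ := by
  rw [unshearFst, map_fibreMap, one_smul]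

/-- The inversion `D` of the first factor acts as `-1` on `H₂(T²; ℤ)`. [folklore] -/
theorem map_invFst (τ : singularHomology ℤ ℤ CircleTorus 2) :
    singularHomology.map ℤ ℤ invFst 2 τ = -τ := by
  rw [invFst, map_fibreMap, neg_one_zsmul]

/-- **Conjugation by the swap preserves scalar actions** (`σ ∘ σ = id`). [folklore] -/
theorem map_conj_swap {f : C(CircleTorus, CircleTorus)} {c : ℤ}
    (hf : ∀ τ : singularHomology ℤ ℤ CircleTorus 2, singularHomology.map ℤ ℤ f 2 τ = c • τ)
    (τ : singularHomology ℤ ℤ CircleTorus 2) :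
    singularHomology.map ℤ ℤ (swap.comp (f.comp swap)) 2 τ = c • τ := by
  rw [singularHomology.map_comp, singularHomology.map_comp, ModuleCat.comp_apply,
    ModuleCat.comp_apply, hf, map_zsmul, ← ModuleCat.comp_apply, ← singularHomology.map_comp,
    swap_comp_swap, singularHomology.map_id, ModuleCat.id_apply]

/-- The shear `L` acts as the identity on `H₂(T²; ℤ)`. [folklore] -/
theorem map_shearSnd (τ : singularHomology ℤ ℤ CircleTorus 2) :
    singularHomology.map ℤ ℤ shearSnd 2 τ = τ := by
  rw [shearSnd, map_conj_swap (c := 1) (fun τ ↦ by rw [map_shearFst, one_smul]), one_smul]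

/-- The inversion `D'` of the second factor acts as `-1` on `H₂(T²; ℤ)`. [folklore] -/
theorem map_invSnd (τ : singularHomology ℤ ℤ CircleTorus 2) :
    singularHomology.map ℤ ℤ invSnd 2 τ = -τ := by
  rw [invSnd, map_conj_swap (c := -1) (fun τ ↦ by rw [map_invFst, neg_one_zsmul]), neg_one_zsmul]

/-- **The coordinate swap acts as `-1` on `H₂(T²; ℤ)`** (`σ = L ∘ U⁻¹ ∘ L ∘ D'`). [folklore] -/
theorem map_swap (τ : singularHomology ℤ ℤ CircleTorus 2) :
    singularHomology.map ℤ ℤ swap 2 τ = -τ := by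
  rw [swap_eq_comp, singularHomology.map_comp, singularHomology.map_comp,
    singularHomology.map_comp, ModuleCat.comp_apply, ModuleCat.comp_apply, ModuleCat.comp_apply,
    map_invSnd, map_neg, map_neg, map_neg, map_shearSnd, map_unshearFst, map_shearSnd]

/-- **`(x, u) ↦ (u, x^b)` acts as `-b` on `H₂(T²; ℤ)`.** [folklore] -/
theorem map_swap_comp_powFst (b : ℤ) (τ : singularHomology ℤ ℤ CircleTorus 2) :
    singularHomology.map ℤ ℤ (swap.comp (powFst b)) 2 τ = -(b • τ) := by
  rw [singularHomology.map_comp, ModuleCat.comp_apply, map_powFst, map_swap]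

/-! ### No torsion -/

/-- `H₁(S¹; ℤ) ≅ ℤ` has no torsion. [folklore] -/
theorem eq_zero_of_zsmul_eq_zero_circle {n : ℤ} (hn : n ≠ 0) (x : singularHomology ℤ ℤ Circle 1)
    (h : n • x = 0) : x = 0 := by
  set e := singularHomologyOneCircleIso.toLinearEquiv with he
  have h' : n • e x = 0 := by rw [← map_zsmul, h, map_zero]
  rw [smul_eq_mul] at h'
  rcases mul_eq_zero.1 h' with h0 | h0
  · exact absurd h0 hn
  · exact e.injective (h0.trans (map_zero e).symm)

/-- `H₁` of a contractible-arc piece has no torsion. [folklore] -/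
theorem Piece.eq_zero_of_zsmul_eq_zero {A : Set Circle} (κ : Contraction A) (hA : A.Nonempty)
    {n : ℤ} (hn : n ≠ 0) (y : singularHomology ℤ ℤ ↥(piece A) 1) (h : n • y = 0) : y = 0 := by
  apply Piece.map_proj_injective κ hA
  rw [map_zero]
  exact eq_zero_of_zsmul_eq_zero_circle hn _ (by rw [← map_zsmul, h, map_zero])

/-- **`H₂(T²; ℤ)` has no torsion**: `n • τ = 0` with `n ≠ 0` forces `τ = 0` (`δ` is injective and
`H₁` of the pieces embeds in `H₁(S¹) ≅ ℤ`). [folklore] -/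
theorem eq_zero_of_zsmul_eq_zero {n : ℤ} (hn : n ≠ 0) (τ : singularHomology ℤ ℤ CircleTorus 2)
    (h : n • τ = 0) : τ = 0 := by
  apply δ₂_injective
  rw [map_zero]
  set y := δ₂ τ with hy
  have hny : n • y = 0 := by rw [hy, ← map_zsmul, h, map_zero]
  obtain ⟨yp, yn, hyy⟩ := singularHomology.exists_eq_map_add_map_of_disjoint_open isOpen_Wpos
    isOpen_Wneg disjoint_Wpos_Wneg Wpos_subset Wneg_subset inter_subset_Wpos_union_Wneg 1 y
  have hpos_ne : ({u : Circle | 0 < (u : ℂ).im}).Nonempty :=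
    ⟨Circle.exp (π / 2), Circle.im_exp_pos (by positivity) (by linarith [Real.pi_pos])⟩
  have hneg_ne : ({u : Circle | (u : ℂ).im < 0}).Nonempty :=
    ⟨Circle.exp (-(π / 2)), Circle.im_exp_neg (by linarith [Real.pi_pos]) (by linarith [Real.pi_pos])⟩
  obtain ⟨up, hup⟩ := hpos_ne
  obtain ⟨un, hun⟩ := hneg_ne
  -- the two retractions of `V₁ ∩ V₂ = Wpos ⊔ Wneg`
  set rp : C(↥(V₁ ∩ V₂), ↥Wpos) := clopenRetract (S := V₁ ∩ V₂) (A := Wpos) (C := Wpos) (D := Wneg)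
    isOpen_Wpos isOpen_Wneg inter_subset_Wpos_union_Wneg
    (fun z _ hzp hzn ↦ Set.disjoint_left.1 disjoint_Wpos_Wneg hzp hzn) (fun _ _ hz ↦ hz)
    ⟨(1, up), hup⟩ with hrp
  set rn : C(↥(V₁ ∩ V₂), ↥Wneg) := clopenRetract (S := V₁ ∩ V₂) (A := Wneg) (C := Wneg) (D := Wpos)
    isOpen_Wneg isOpen_Wpos (fun z hz ↦ (inter_subset_Wpos_union_Wneg hz).symm)
    (fun z _ hzn hzp ↦ Set.disjoint_left.1 disjoint_Wpos_Wneg hzp hzn) (fun _ _ hz ↦ hz)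
    ⟨(1, un), hun⟩ with hrn
  have hrp_p : rp.comp (subsetInclusion Wpos_subset) = ContinuousMap.id _ := by
    refine ContinuousMap.ext fun z ↦ Subtype.ext ?_
    rw [ContinuousMap.comp_apply, hrp]
    exact clopenRetract_apply_of_mem _ _ _ _ _ _ _ z.2
  have hrp_n : ∀ z, rp.comp (subsetInclusion Wneg_subset) z = ⟨(1, up), hup⟩ := fun z ↦ by
    rw [ContinuousMap.comp_apply, hrp]
    exact clopenRetract_apply_of_not_mem _ _ _ _ _ _ _
      (fun hz ↦ Set.disjoint_left.1 disjoint_Wpos_Wneg hz z.2)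
  have hrn_n : rn.comp (subsetInclusion Wneg_subset) = ContinuousMap.id _ := by
    refine ContinuousMap.ext fun z ↦ Subtype.ext ?_
    rw [ContinuousMap.comp_apply, hrn]
    exact clopenRetract_apply_of_mem _ _ _ _ _ _ _ z.2
  have hrn_p : ∀ z, rn.comp (subsetInclusion Wpos_subset) z = ⟨(1, un), hun⟩ := fun z ↦ by
    rw [ContinuousMap.comp_apply, hrn]
    exact clopenRetract_apply_of_not_mem _ _ _ _ _ _ _
      (fun hz ↦ Set.disjoint_left.1 disjoint_Wpos_Wneg z.2 hz)
  have hyp : singularHomology.map ℤ ℤ rp 1 y = yp := by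
    rw [hyy, map_add, ← ModuleCat.comp_apply, ← ModuleCat.comp_apply, ← singularHomology.map_comp,
      ← singularHomology.map_comp, hrp_p, singularHomology.map_id, ModuleCat.id_apply,
      singularHomology.map_eq_zero_of_forall_eq _ _ hrp_n one_ne_zero]
    simp
  have hyn : singularHomology.map ℤ ℤ rn 1 y = yn := by
    rw [hyy, map_add, ← ModuleCat.comp_apply, ← ModuleCat.comp_apply, ← singularHomology.map_comp,
      ← singularHomology.map_comp, hrn_n, singularHomology.map_id, ModuleCat.id_apply,
      singularHomology.map_eq_zero_of_forall_eq _ _ hrn_p one_ne_zero]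
    simp
  have hyp0 : yp = 0 := Piece.eq_zero_of_zsmul_eq_zero contractionImPos ⟨up, hup⟩ hn yp (by
    have := congrArg (singularHomology.map ℤ ℤ rp 1) hny
    rwa [map_zsmul, map_zero, hyp] at this)
  have hyn0 : yn = 0 := Piece.eq_zero_of_zsmul_eq_zero contractionImNeg ⟨un, hun⟩ hn yn (by
    have := congrArg (singularHomology.map ℤ ℤ rn 1) hny
    rwa [map_zsmul, map_zero, hyn] at this)
  rw [hyy, hyp0, hyn0, map_zero, map_zero, add_zero]

end CircleTorus

end Literature.Topology.FourManifolds
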